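import Literature.AnabelianGeometry.SemiGraphs.FiniteEtaleCoveringLocalGlobalSection
import Literature.AnabelianGeometry.SemiGraphs.FiniteEtaleCoveringBranchSection
import Literature.AnabelianGeometry.SemiGraphs.OverStarSectionNaturality

/-!
# The gluing of a global object read through the vertex, branch and edge comparisons of a finite
# étale covering ([SemiAnbd] Def. 2.2 (i) p. 23, Rem. 2.4.2 p. 26)

Mochizuki, *Semi-graphs of anabelioids*, Publ. RIMS **42** (2006) 221–322, §2: Def. 2.2 (i) p. 23 (the
covering `ℋ → 𝒦` attached to `A ∈ B(𝒦)`: "`B′ = B(𝒦)_{/A}`", "`ℋ_w` is the anabelioid `(𝒦_u)_P`", the edge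
components placed under the vertex components "via `ψ_b`") and Rem. 2.4.2 p. 26 (the 2-cells `ψ_b`)
[cite: MochizukiSemiAnbd2006, Def. 2.2(i) p.23].

PROOF-ONLY (abc-iut cell, layer L3; FACT-LIST row F-1478 `remark_2_4_1_covering`, residual (L) «print's
finite étale coverings compose, LOCAL clause», brick **(L-B)** «branch clause of the composite» of
`HOME/staging/w5/w5-d041-g3/L-LOCAL-CLAUSE-DECOMPOSITION.md`; seat abc-iut-w5-d041).  For `ψ : ℋ → 𝒦` with a
global witness `(αψ, e_ψ)`, a branch `b′` of `ℋ` at `w` over `b` at `u`, and local witnesses `(α_w, e_w)` at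
`w` on `P`, `(α_f, e_f)` at the edge `e′` of `b′` on `Q` (presentation `ψ e′ = edgeOf b`), three comparison
functors are in the tree: the VERTEX comparison `K_w = αψ ⋙ ρ_w ⋙ α_w⁻¹` (abc-iut-w5-d041,
`Hom.localGlobalFunctor`), the BRANCH comparison `L_b = α_w ⋙ b′^* ⋙ α_f⁻¹` (abc-iut-f-160,
`Hom.branchLocalFunctor`) and the EDGE comparison `K_{e′} = αψ ⋙ ρ_{e′} ⋙ α_f⁻¹` (abc-iut-w4-d079, written
out), each with its identification `ι` on star objects.  This file proves that they are COMPATIBLE with the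
gluing `γ_Y : L_b(K_w Y) ⥲ K_{e′} Y` (counit of `α_w`, then the gluing `(αψ Y).ψ_{b′}` of the global object):

* `Hom.map_localGlobalIso_hom_app_comp'`, `Hom.map_branchLocalIso_hom_app_comp`,
  `Hom.map_localGlobalIsoE_hom_app_comp'` — the three identifications unwound through the local
  equivalences (triangle identities), at an arbitrary object;
* `Hom.compGluing_naturality` — naturality of `γ`;
* `Hom.compGluing_star` — **(★) on star objects, `γ` intertwines the composite identification
  `L_b(ι_w) ≫ ι_L ≫ (Q × ψ_b^Z)` with `ι_{e′}`** (the 2-cell `ψ_{b′}` inside `ι_L` is the one inside the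
  gluing of `ψ^* Z`; `BObj.Hom.comm` for `e_ψ⁻¹`);
* `Hom.compGluing_pieces` — **consequence for the PIECES**: for any rigidity isomorphisms
  `ε_w : K_w X ≅ P ×_{σ_w} X_u`, `ε_b : L_b(K_w X) ≅ Q ×_{σ_b} b^*(K_w X)`, `ε_{e′} : K_{e′} X ≅ Q ×_{σ_{e′}} X_e`
  with their defining compatibilities (`OverStar.exists_iso_pullback`), `γ_X` read on underlying objects
  into `X_e` is `Q ×_{σ_b} b^*(K_w X) → b^*((K_w X).left) → b^* X_u ⥲ X_e` — the input `hγ` of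
  abc-iut-L3-t1's abstract branch step `componentIn_branch` for Route W.

No `def`, no new `Prop`; nothing here takes a side on [IUTchIII] Cor. 3.12; typed ≠ proved for F-1478.
-/

namespace Literature.AnabelianGeometry.SemiGraphs

namespace SemiGraphOfAnabelioids

namespace Hom

open CategoryTheory CategoryTheory.Limits

universe v₁ u₁ u

-- Mathlib's `Over.pullback` / `Over.post` simp lemmas only fire under the pre-v4.2x defeq transparency
-- behaviour, exactly as in `Mathlib/CategoryTheory/Comma/Over/Pullback.lean`.
set_option backward.isDefEq.respectTransparency false

/-- Triangle identity of an adjoint equivalence `G`, re-associated: `ε⁻¹_{G Z} ≫ G(η⁻¹_Z) ≫ f = f`.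
[cite: MochizukiSemiAnbd2006, Def. 2.2(i) p.23] -/
theorem counitInv_app_comp_map_unitInv_comp_eq {C D : Type*} [Category C] [Category D] (G : C ⥤ D)
    [G.IsEquivalence] (Z : C) {X : D} (f : G.obj Z ⟶ X) :
    G.asEquivalence.counitIso.inv.app (G.obj Z) ≫ G.map (G.asEquivalence.unitIso.inv.app Z) ≫ f = f := by
  rw [← Category.assoc]
  exact (congrArg (· ≫ f) (G.asEquivalence.counitInv_functor_comp Z)).trans (Category.id_comp f)

section EdgeIso

variable {ℋ 𝒦 : SemiGraphOfAnabelioids.{v₁, u₁, u}} (ψ : Hom ℋ 𝒦) (A : 𝒦.BObj)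
  [HasBinaryProducts 𝒦.BObj] (αψ : Over A ⥤ ℋ.BObj)
  (eψ : ψ.pullbackFunctor ≅ Over.star A ⋙ αψ) (e' : ℋ.graph.Edge) (f : 𝒦.graph.Edge)
  (p : ψ.base.edgeMap e' = f) (Q : 𝒦.E f) (αE : Over Q ⥤ ℋ.E e') [αE.IsEquivalence]
  (eEloc : (ψ.φE e' f p).pullback ≅ Over.star Q ⋙ αE)

/-- EDGE: `α_f(ι_{e′} Z) ≫ e_f⁻¹_{Z_f} = ε ≫ (e_ψ⁻¹_Z)_{e′} ≫ reindex_Z` (abc-iut-w4-d079's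
`map_localGlobalIsoE_hom_app_comp`, verbatim, at an arbitrary `Z ∈ B(𝒦)` instead of `A`).
[cite: MochizukiSemiAnbd2006, Def. 2.2(i) p.23] -/
theorem map_localGlobalIsoE_hom_app_comp' (Z : 𝒦.BObj) :
    αE.map ((Functor.isoWhiskerRight eψ.symm (ℋ.ρE e' ⋙ αE.inv) ≪≫
        Functor.isoWhiskerRight (ψ.reindexIso e' (ψ.base.edgeMap e') f rfl p) αE.inv ≪≫
        Functor.isoWhiskerLeft (𝒦.ρE f) (Functor.isoWhiskerRight eEloc αE.inv) ≪≫
        Functor.isoWhiskerLeft (𝒦.ρE f ⋙ Over.star Q) αE.asEquivalence.unitIso.symm :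
          Over.star A ⋙ (αψ ⋙ ℋ.ρE e' ⋙ αE.inv) ≅ 𝒦.ρE f ⋙ Over.star Q).hom.app Z) ≫
        eEloc.inv.app (Z.T f) =
      αE.asEquivalence.counitIso.hom.app ((αψ.obj ((Over.star A).obj Z)).T e') ≫
        (eψ.inv.app Z).fT e' ≫ (ψ.reindexIso e' (ψ.base.edgeMap e') f rfl p).hom.app Z := by
  subst p
  have hr : ψ.reindexIso e' (ψ.base.edgeMap e') (ψ.base.edgeMap e') rfl rfl = Iso.refl _ := rfl
  simp only [hr, Iso.trans_hom, NatTrans.comp_app, Functor.isoWhiskerRight_hom,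
    Functor.isoWhiskerLeft_hom, Functor.whiskerRight_app, Functor.whiskerLeft_app, Iso.symm_hom,
    Iso.refl_hom, NatTrans.id_app, Functor.comp_map, CategoryTheory.Functor.map_comp, Category.assoc]
  simp only [Functor.fun_inv_map, Category.assoc]
  erw [Category.id_comp]
  erw [Equivalence.counitIso_inv_hom_id_app_assoc]
  erw [Equivalence.counitIso_inv_hom_id_app_assoc]
  erw [counitInv_app_comp_map_unitInv_comp_eq]
  erw [Iso.hom_inv_id_app]
  erw [Category.comp_id]
  rfl

end EdgeIso

variable {ℋ 𝒦 : SemiGraphOfAnabelioids.{v₁, u₁, u}} (ψ : Hom ℋ 𝒦) (A : 𝒦.BObj)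
  [HasBinaryProducts 𝒦.BObj] (αψ : Over A ⥤ ℋ.BObj) [αψ.IsEquivalence]
  (eψ : ψ.pullbackFunctor ≅ Over.star A ⋙ αψ)
  (b' : ℋ.graph.Branch) (w : ℋ.graph.Vertex) (h' : ℋ.graph.abuts b' = some w)
  (P : 𝒦.V (ψ.base.vertexMap w)) (αw : Over P ⥤ ℋ.V w) [αw.IsEquivalence]
  (ew : (ψ.φV w).pullback ≅ Over.star P ⋙ αw)
  (Q : 𝒦.E (𝒦.graph.edgeOf (ψ.base.branchMap b')))
  (αf : Over Q ⥤ ℋ.E (ℋ.graph.edgeOf b')) [αf.IsEquivalence]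
  (ef : (ψ.φE (ℋ.graph.edgeOf b') (𝒦.graph.edgeOf (ψ.base.branchMap b'))
    (ψ.base.edgeOf_branchMap b').symm).pullback ≅ Over.star Q ⋙ αf)

/-! ### The vertex and branch identifications unwound (at an arbitrary object) -/

omit [αψ.IsEquivalence] in
/-- VERTEX: `α_w(ι_w Z) ≫ e_w⁻¹_{Z_u} = ε ≫ (e_ψ⁻¹_Z)_w` (abc-iut-w4-d079's `map_localGlobalIso_hom_app_comp`
at an arbitrary `Z ∈ B(𝒦)`). [cite: MochizukiSemiAnbd2006, Def. 2.2(i) p.23] -/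
theorem map_localGlobalIso_hom_app_comp' (Z : 𝒦.BObj) :
    αw.map ((Hom.localGlobalIso ψ A αψ w P αw eψ ew).hom.app Z) ≫
        ew.inv.app (Z.S (ψ.base.vertexMap w)) =
      αw.asEquivalence.counitIso.hom.app ((αψ.obj ((Over.star A).obj Z)).S w) ≫
        (eψ.inv.app Z).fS w := by
  simp only [Hom.localGlobalIso, Iso.trans_hom, NatTrans.comp_app, Functor.isoWhiskerRight_hom,
    Functor.isoWhiskerLeft_hom, Functor.whiskerRight_app, Functor.whiskerLeft_app, Iso.symm_hom,
    eqToIso.hom, Functor.comp_map, CategoryTheory.Functor.map_comp, Category.assoc]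
  simp only [Functor.fun_inv_map, Category.assoc]
  erw [NatTrans.id_app]
  erw [Category.id_comp]
  erw [Equivalence.counitIso_inv_hom_id_app_assoc]
  erw [Equivalence.counitIso_inv_hom_id_app_assoc]
  erw [counitInv_app_comp_map_unitInv_comp_eq]
  erw [Iso.hom_inv_id_app]
  erw [Category.comp_id]
  rfl

omit [αψ.IsEquivalence] [αw.IsEquivalence] [HasBinaryProducts 𝒦.BObj] in
/-- BRANCH: `α_f(ι_L U) ≫ e_f⁻¹_{b^* U} = ε ≫ b′^*(e_w⁻¹_U) ≫ (ψ_{b′})_U` (abc-iut-f-160's `branchLocalIso`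
unwound). [cite: MochizukiSemiAnbd2006, Rem. 2.4.2 p.26] -/
theorem map_branchLocalIso_hom_app_comp (U : 𝒦.V (ψ.base.vertexMap w)) :
    αf.map ((Hom.branchLocalIso ψ b' w h' P αw Q αf ew ef).hom.app U) ≫
        ef.inv.app ((𝒦.pull (ψ.base.branchMap b') (ψ.base.vertexMap w)
          (ψ.base.abuts_branchMap b' w h')).pullback.obj U) =
      αf.asEquivalence.counitIso.hom.app
          ((ℋ.pull b' w h').pullback.obj (αw.obj ((Over.star P).obj U))) ≫
        (ℋ.pull b' w h').pullback.map (ew.inv.app U) ≫ (ψ.φB b' w h').hom.app U := by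
  simp only [Hom.branchLocalIso, Iso.trans_hom, NatTrans.comp_app, Functor.isoWhiskerRight_hom,
    Functor.isoWhiskerLeft_hom, Functor.whiskerRight_app, Functor.whiskerLeft_app, Iso.symm_hom,
    Functor.comp_map, CategoryTheory.Functor.map_comp, Category.assoc]
  simp only [Functor.fun_inv_map, Category.assoc]
  erw [Equivalence.counitIso_inv_hom_id_app_assoc]
  erw [Equivalence.counitIso_inv_hom_id_app_assoc]
  erw [counitInv_app_comp_map_unitInv_comp_eq]
  erw [Iso.hom_inv_id_app]
  erw [Category.comp_id]
  rfl

/-! ### The gluing `γ_Y : L_b(K_w Y) ⥲ K_{e′} Y` and its naturality -/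

omit [HasBinaryProducts 𝒦.BObj] [αψ.IsEquivalence] in
/-- Naturality of `γ_Y := α_f⁻¹(b′^*(ε_{(αψ Y)_w}) ≫ (αψ Y).ψ_{b′})` in `Y ∈ B(𝒦)_{/A}` (counit naturality
and `BObj.Hom.comm` for `αψ(g)`). [cite: MochizukiSemiAnbd2006, Def. 2.1 p.23] -/
theorem compGluing_naturality {Y Y' : Over A} (g : Y ⟶ Y') :
    αf.inv.map ((ℋ.pull b' w h').pullback.map
          (αw.asEquivalence.counitIso.hom.app ((αψ.obj Y).S w)) ≫ ((αψ.obj Y).ψ b' w h').hom) ≫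
        (αψ ⋙ ℋ.ρE (ℋ.graph.edgeOf b') ⋙ αf.inv).map g =
      (Hom.localGlobalFunctor ψ A αψ w P αw ⋙ Hom.branchLocalFunctor ψ b' w h' P αw Q αf).map g ≫
        αf.inv.map ((ℋ.pull b' w h').pullback.map
          (αw.asEquivalence.counitIso.hom.app ((αψ.obj Y').S w)) ≫ ((αψ.obj Y').ψ b' w h').hom) := by
  change _ ≫ αf.inv.map ((αψ.map g).fT (ℋ.graph.edgeOf b')) =
    αf.inv.map ((ℋ.pull b' w h').pullback.map (αw.map (αw.inv.map ((αψ.map g).fS w)))) ≫ _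
  rw [← Functor.map_comp, ← Functor.map_comp, Category.assoc, ← (αψ.map g).comm b' w h',
    ← Functor.map_comp_assoc, ← Functor.map_comp_assoc]
  congr 3
  exact (αw.asEquivalence.counitIso.hom.naturality ((αψ.map g).fS w)).symm

/-! ### (★) The gluing on star objects -/

omit [αψ.IsEquivalence] in
/-- **(★)** On a star object `A × Z`, the gluing `γ` followed by the EDGE identification `ι_{e′}` is the
BRANCH comparison applied to the VERTEX identification `ι_w`, then the branch identification `ι_L`, then
`Q × ψ_b^Z` (the gluing of `Z` itself).  Both sides unwind, through `α_f` and `e_f`, to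
`ε ≫ b′^*(ε ≫ (e_ψ⁻¹_Z)_w) ≫ (ψ_{b′})_{Z_u} ≫ ψ_{e′}^*(ψ_b^Z)`: on the left by `BObj.Hom.comm` for `e_ψ⁻¹_Z`
and the definition of the gluing of `ψ^* Z` (`Hom.gluingIso`), on the right by naturality of `e_f`.
[cite: MochizukiSemiAnbd2006, Rem. 2.4.2 p.26] -/
theorem compGluing_star (Z : 𝒦.BObj) :
    αf.inv.map ((ℋ.pull b' w h').pullback.map
          (αw.asEquivalence.counitIso.hom.app ((αψ.obj ((Over.star A).obj Z)).S w)) ≫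
          ((αψ.obj ((Over.star A).obj Z)).ψ b' w h').hom) ≫
        (Functor.isoWhiskerRight eψ.symm (ℋ.ρE (ℋ.graph.edgeOf b') ⋙ αf.inv) ≪≫
          Functor.isoWhiskerRight (ψ.reindexIso (ℋ.graph.edgeOf b') (ψ.base.edgeMap (ℋ.graph.edgeOf b'))
            (𝒦.graph.edgeOf (ψ.base.branchMap b')) rfl (ψ.base.edgeOf_branchMap b').symm) αf.inv ≪≫
          Functor.isoWhiskerLeft (𝒦.ρE (𝒦.graph.edgeOf (ψ.base.branchMap b')))
            (Functor.isoWhiskerRight ef αf.inv) ≪≫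
          Functor.isoWhiskerLeft (𝒦.ρE (𝒦.graph.edgeOf (ψ.base.branchMap b')) ⋙ Over.star Q)
            αf.asEquivalence.unitIso.symm :
            Over.star A ⋙ (αψ ⋙ ℋ.ρE (ℋ.graph.edgeOf b') ⋙ αf.inv) ≅
              𝒦.ρE (𝒦.graph.edgeOf (ψ.base.branchMap b')) ⋙ Over.star Q).hom.app Z =
      (Hom.branchLocalFunctor ψ b' w h' P αw Q αf).map
          ((Hom.localGlobalIso ψ A αψ w P αw eψ ew).hom.app Z) ≫
        (Hom.branchLocalIso ψ b' w h' P αw Q αf ew ef).hom.app (Z.S (ψ.base.vertexMap w)) ≫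
        (Over.star Q).map (Z.ψ (ψ.base.branchMap b') (ψ.base.vertexMap w)
          (ψ.base.abuts_branchMap b' w h')).hom := by
  apply αf.map_injective
  rw [← cancel_mono (ef.inv.app (Z.T (𝒦.graph.edgeOf (ψ.base.branchMap b'))))]
  -- left-hand side: `ε ≫ b′^*(ε) ≫ b′^*((e_ψ⁻¹_Z)_w) ≫ (ψ^* Z).ψ_{b′} ≫ reindex`
  rw [Functor.map_comp, Category.assoc, map_localGlobalIsoE_hom_app_comp', Functor.fun_inv_map]
  simp only [Category.assoc]
  erw [Equivalence.counitIso_inv_hom_id_app_assoc]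
  have hc : (ℋ.pull b' w h').pullback.map ((eψ.inv.app Z).fS w) ≫
      ((ψ.pullbackFunctor.obj Z).ψ b' w h').hom =
        ((αψ.obj ((Over.star A).obj Z)).ψ b' w h').hom ≫ (eψ.inv.app Z).fT (ℋ.graph.edgeOf b') :=
    (eψ.inv.app Z).comm b' w h'
  rw [← reassoc_of% hc]
  -- the gluing of `ψ^* Z` along `b′`, followed by the two re-indexings (which cancel)
  have h4 : ((ψ.pullbackFunctor.obj Z).ψ b' w h').hom ≫
      (ψ.reindexIso (ℋ.graph.edgeOf b') (ψ.base.edgeMap (ℋ.graph.edgeOf b'))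
        (𝒦.graph.edgeOf (ψ.base.branchMap b')) rfl (ψ.base.edgeOf_branchMap b').symm).hom.app Z =
      (ψ.φB b' w h').hom.app (Z.S (ψ.base.vertexMap w)) ≫
        (ψ.φE (ℋ.graph.edgeOf b') (𝒦.graph.edgeOf (ψ.base.branchMap b'))
          (ψ.base.edgeOf_branchMap b').symm).pullback.map
          (Z.ψ (ψ.base.branchMap b') (ψ.base.vertexMap w) (ψ.base.abuts_branchMap b' w h')).hom := by
    change ((ψ.gluingIso b' w h').app Z).hom ≫ _ = _
    simp only [Iso.app_hom, Hom.gluingIso, Iso.trans_hom, NatTrans.comp_app,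
      Functor.isoWhiskerLeft_hom, Functor.isoWhiskerRight_hom, Functor.whiskerLeft_app,
      Functor.whiskerRight_app, ψNatIso, NatIso.ofComponents_hom_app, Hom.reindexIso, eqToIso.hom,
      eqToHom_app, Category.assoc, eqToHom_trans, eqToHom_refl, Category.comp_id]
    rfl
  rw [h4]
  -- right-hand side: naturality of `e_f`, the branch identification, the vertex identification
  have h1 : αf.map ((Over.star Q).map (Z.ψ (ψ.base.branchMap b') (ψ.base.vertexMap w)
        (ψ.base.abuts_branchMap b' w h')).hom) ≫
        ef.inv.app (Z.T (𝒦.graph.edgeOf (ψ.base.branchMap b'))) =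
      ef.inv.app ((𝒦.pull (ψ.base.branchMap b') (ψ.base.vertexMap w)
        (ψ.base.abuts_branchMap b' w h')).pullback.obj (Z.S (ψ.base.vertexMap w))) ≫
        (ψ.φE (ℋ.graph.edgeOf b') (𝒦.graph.edgeOf (ψ.base.branchMap b'))
          (ψ.base.edgeOf_branchMap b').symm).pullback.map
          (Z.ψ (ψ.base.branchMap b') (ψ.base.vertexMap w) (ψ.base.abuts_branchMap b' w h')).hom :=
    ef.inv.naturality _
  have h3 : αf.map ((Hom.branchLocalFunctor ψ b' w h' P αw Q αf).map
        ((Hom.localGlobalIso ψ A αψ w P αw eψ ew).hom.app Z)) =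
      αf.asEquivalence.counit.app _ ≫
        (ℋ.pull b' w h').pullback.map (αw.map ((Hom.localGlobalIso ψ A αψ w P αw eψ ew).hom.app Z)) ≫
        αf.asEquivalence.counitInv.app _ :=
    Functor.fun_inv_map αf _ _ _
  have h5 := congrArg ((ℋ.pull b' w h').pullback.map) (map_localGlobalIso_hom_app_comp' ψ A αψ eψ w P αw ew Z)
  rw [Functor.map_comp, Functor.map_comp] at h5
  rw [Functor.map_comp, Functor.map_comp, Category.assoc, Category.assoc, h1,
    reassoc_of% (map_branchLocalIso_hom_app_comp ψ b' w h' P αw ew Q αf ef (Z.S (ψ.base.vertexMap w))),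
    h3]
  simp only [Category.assoc]
  erw [Equivalence.counitIso_inv_hom_id_app_assoc]
  rw [reassoc_of% h5]
  rfl

/-! ### Consequence for the pieces (the input `hγ` of `componentIn_branch`) -/

/-- **The gluing read on the pieces.**  For rigidity isomorphisms `ε_w : K_w X ≅ P ×_{σ_w} X_u`,
`ε_b : L_b(K_w X) ≅ Q ×_{σ_b} b^*(K_w X)` and `ε_{e′} : K_{e′} X ≅ Q ×_{σ_{e′}} X_e` satisfying their defining
compatibilities with the structure maps (`OverStar.exists_iso_pullback`), the gluing `γ_X` read on
underlying objects into `X_e` equals `Q ×_{σ_b} b^*(K_w X) → b^*((K_w X).left) → b^* X_u ⥲ X_e`: the branch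
piece of the vertex piece IS the edge piece, through `ψ_b^X`.  (Transposes along `forget ⊣ star`,
naturality of `γ` and of the identifications, and (★).) [cite: MochizukiSemiAnbd2006, Def. 2.2(i) p.23] -/
theorem compGluing_pieces (X : Over A)
    (hT : IsTerminal ((αψ ⋙ ℋ.ρE (ℋ.graph.edgeOf b') ⋙ αf.inv).obj (Over.mk (𝟙 A))))
    (εV : (Hom.localGlobalFunctor ψ A αψ w P αw).obj X ≅
      OverStar.pullbackObj (Hom.localGlobalSection ψ A αψ w P αw eψ ew) (X.hom.fS (ψ.base.vertexMap w)))
    (hεV : εV.hom ≫ OverStar.pullbackι (Over.forgetAdjStar P) (Hom.localGlobalSection ψ A αψ w P αw eψ ew)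
        (X.hom.fS (ψ.base.vertexMap w)) =
      (Hom.localGlobalFunctor ψ A αψ w P αw).map (OverStar.unit' (Over.forgetAdjStar A) X) ≫
        OverStar.ιHom (Hom.localGlobalFunctor ψ A αψ w P αw) (𝒦.ρ (ψ.base.vertexMap w))
          (Hom.localGlobalIso ψ A αψ w P αw eψ ew) X.left)
    (εB : (Hom.branchLocalFunctor ψ b' w h' P αw Q αf).obj ((Hom.localGlobalFunctor ψ A αψ w P αw).obj X) ≅
      OverStar.pullbackObj (Hom.branchSection ψ b' w h' P αw Q αf ew ef)
        ((𝒦.pull (ψ.base.branchMap b') (ψ.base.vertexMap w) (ψ.base.abuts_branchMap b' w h')).pullback.map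
          ((Hom.localGlobalFunctor ψ A αψ w P αw).obj X).hom))
    (hεB : εB.hom ≫ OverStar.pullbackι (Over.forgetAdjStar Q) (Hom.branchSection ψ b' w h' P αw Q αf ew ef)
        ((𝒦.pull (ψ.base.branchMap b') (ψ.base.vertexMap w) (ψ.base.abuts_branchMap b' w h')).pullback.map
          ((Hom.localGlobalFunctor ψ A αψ w P αw).obj X).hom) =
      (Hom.branchLocalFunctor ψ b' w h' P αw Q αf).map
          (OverStar.unit' (Over.forgetAdjStar P) ((Hom.localGlobalFunctor ψ A αψ w P αw).obj X)) ≫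
        OverStar.ιHom (Hom.branchLocalFunctor ψ b' w h' P αw Q αf)
          (𝒦.pull (ψ.base.branchMap b') (ψ.base.vertexMap w) (ψ.base.abuts_branchMap b' w h')).pullback
          (Hom.branchLocalIso ψ b' w h' P αw Q αf ew ef) ((Hom.localGlobalFunctor ψ A αψ w P αw).obj X).left)
    (εE : (αψ ⋙ ℋ.ρE (ℋ.graph.edgeOf b') ⋙ αf.inv).obj X ≅
      OverStar.pullbackObj
        (OverStar.sectionMap (Over.forgetAdjStar A) (Over.forgetAdjStar Q)
          (αψ ⋙ ℋ.ρE (ℋ.graph.edgeOf b') ⋙ αf.inv) (𝒦.ρE (𝒦.graph.edgeOf (ψ.base.branchMap b')))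
          (Functor.isoWhiskerRight eψ.symm (ℋ.ρE (ℋ.graph.edgeOf b') ⋙ αf.inv) ≪≫
            Functor.isoWhiskerRight (ψ.reindexIso (ℋ.graph.edgeOf b') (ψ.base.edgeMap (ℋ.graph.edgeOf b'))
              (𝒦.graph.edgeOf (ψ.base.branchMap b')) rfl (ψ.base.edgeOf_branchMap b').symm) αf.inv ≪≫
            Functor.isoWhiskerLeft (𝒦.ρE (𝒦.graph.edgeOf (ψ.base.branchMap b')))
              (Functor.isoWhiskerRight ef αf.inv) ≪≫
            Functor.isoWhiskerLeft (𝒦.ρE (𝒦.graph.edgeOf (ψ.base.branchMap b')) ⋙ Over.star Q)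
              αf.asEquivalence.unitIso.symm :
              Over.star A ⋙ (αψ ⋙ ℋ.ρE (ℋ.graph.edgeOf b') ⋙ αf.inv) ≅
                𝒦.ρE (𝒦.graph.edgeOf (ψ.base.branchMap b')) ⋙ Over.star Q) hT)
        (X.hom.fT (𝒦.graph.edgeOf (ψ.base.branchMap b'))))
    (hεE : εE.hom ≫ OverStar.pullbackι (Over.forgetAdjStar Q)
        (OverStar.sectionMap (Over.forgetAdjStar A) (Over.forgetAdjStar Q)
          (αψ ⋙ ℋ.ρE (ℋ.graph.edgeOf b') ⋙ αf.inv) (𝒦.ρE (𝒦.graph.edgeOf (ψ.base.branchMap b')))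
          (Functor.isoWhiskerRight eψ.symm (ℋ.ρE (ℋ.graph.edgeOf b') ⋙ αf.inv) ≪≫
            Functor.isoWhiskerRight (ψ.reindexIso (ℋ.graph.edgeOf b') (ψ.base.edgeMap (ℋ.graph.edgeOf b'))
              (𝒦.graph.edgeOf (ψ.base.branchMap b')) rfl (ψ.base.edgeOf_branchMap b').symm) αf.inv ≪≫
            Functor.isoWhiskerLeft (𝒦.ρE (𝒦.graph.edgeOf (ψ.base.branchMap b')))
              (Functor.isoWhiskerRight ef αf.inv) ≪≫
            Functor.isoWhiskerLeft (𝒦.ρE (𝒦.graph.edgeOf (ψ.base.branchMap b')) ⋙ Over.star Q)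
              αf.asEquivalence.unitIso.symm :
              Over.star A ⋙ (αψ ⋙ ℋ.ρE (ℋ.graph.edgeOf b') ⋙ αf.inv) ≅
                𝒦.ρE (𝒦.graph.edgeOf (ψ.base.branchMap b')) ⋙ Over.star Q) hT)
        (X.hom.fT (𝒦.graph.edgeOf (ψ.base.branchMap b'))) =
      (αψ ⋙ ℋ.ρE (ℋ.graph.edgeOf b') ⋙ αf.inv).map (OverStar.unit' (Over.forgetAdjStar A) X) ≫
        OverStar.ιHom (αψ ⋙ ℋ.ρE (ℋ.graph.edgeOf b') ⋙ αf.inv) (𝒦.ρE (𝒦.graph.edgeOf (ψ.base.branchMap b')))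
          (Functor.isoWhiskerRight eψ.symm (ℋ.ρE (ℋ.graph.edgeOf b') ⋙ αf.inv) ≪≫
            Functor.isoWhiskerRight (ψ.reindexIso (ℋ.graph.edgeOf b') (ψ.base.edgeMap (ℋ.graph.edgeOf b'))
              (𝒦.graph.edgeOf (ψ.base.branchMap b')) rfl (ψ.base.edgeOf_branchMap b').symm) αf.inv ≪≫
            Functor.isoWhiskerLeft (𝒦.ρE (𝒦.graph.edgeOf (ψ.base.branchMap b')))
              (Functor.isoWhiskerRight ef αf.inv) ≪≫
            Functor.isoWhiskerLeft (𝒦.ρE (𝒦.graph.edgeOf (ψ.base.branchMap b')) ⋙ Over.star Q)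
              αf.asEquivalence.unitIso.symm :
              Over.star A ⋙ (αψ ⋙ ℋ.ρE (ℋ.graph.edgeOf b') ⋙ αf.inv) ≅
                𝒦.ρE (𝒦.graph.edgeOf (ψ.base.branchMap b')) ⋙ Over.star Q) X.left) :
    (αf.inv.map ((ℋ.pull b' w h').pullback.map
          (αw.asEquivalence.counitIso.hom.app ((αψ.obj X).S w)) ≫ ((αψ.obj X).ψ b' w h').hom)).left ≫
        εE.hom.left ≫ pullback.snd _ _ =
      (εB.hom.left ≫ pullback.snd _ _) ≫
        (𝒦.pull (ψ.base.branchMap b') (ψ.base.vertexMap w) (ψ.base.abuts_branchMap b' w h')).pullback.map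
          (εV.hom.left ≫ pullback.snd _ _) ≫
        (X.left.ψ (ψ.base.branchMap b') (ψ.base.vertexMap w) (ψ.base.abuts_branchMap b' w h')).hom := by
  -- left: transpose of `γ ≫ ε_{e′} ≫ pullbackι = γ ≫ K_{e′}(unit′) ≫ ι = L(K_w(unit′)) ≫ γ ≫ ι`, then (★)
  rw [OverStar.ιHom_eq] at hεV
  rw [← OverStar.tr_pullbackι (Over.forgetAdjStar Q)
      (OverStar.sectionMap (Over.forgetAdjStar A) (Over.forgetAdjStar Q)
        (αψ ⋙ ℋ.ρE (ℋ.graph.edgeOf b') ⋙ αf.inv) (𝒦.ρE (𝒦.graph.edgeOf (ψ.base.branchMap b'))) _ hT)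
      (X.hom.fT (𝒦.graph.edgeOf (ψ.base.branchMap b'))),
    ← OverStar.tr_precomp, ← OverStar.tr_precomp, Category.assoc, hεE, ← Category.assoc,
    compGluing_naturality ψ A αψ b' w h' P αw Q αf, Category.assoc, OverStar.ιHom_eq,
    compGluing_star ψ A αψ eψ b' w h' P αw ew Q αf ef X.left,
    ← OverStar.tr_pullbackι (Over.forgetAdjStar Q) (Hom.branchSection ψ b' w h' P αw Q αf ew ef),
    ← OverStar.tr_comp_map (Over.forgetAdjStar Q), ← OverStar.tr_precomp]
  congr 1
  -- inside the transpose: `L(K_w(unit′)) ≫ L(ι_w) ≫ ι_L ≫ (Q × ψ_b) = ε_b ≫ pullbackι ≫ (Q × (b^*(ε_w ≫ snd) ≫ ψ_b))`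
  change (Hom.branchLocalFunctor ψ b' w h' P αw Q αf).map
      ((Hom.localGlobalFunctor ψ A αψ w P αw).map (OverStar.unit' (Over.forgetAdjStar A) X)) ≫ _ = _
  have hun : ∀ {Y Y' : Over P} (g : Y ⟶ Y') {T : Over P} (k : (Over.star P).obj Y'.left ⟶ T),
      g ≫ OverStar.unit' (Over.forgetAdjStar P) Y' ≫ k =
        OverStar.unit' (Over.forgetAdjStar P) Y ≫ (Over.star P).map g.left ≫ k := fun g _ k => by
    rw [← Category.assoc, OverStar.unit'_naturality, Category.assoc]
  have hιn : ∀ {U U' : 𝒦.V (ψ.base.vertexMap w)} (f : U ⟶ U') {T : Over Q}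
      (k : (Over.star Q).obj ((𝒦.pull (ψ.base.branchMap b') (ψ.base.vertexMap w)
        (ψ.base.abuts_branchMap b' w h')).pullback.obj U') ⟶ T),
      (Hom.branchLocalFunctor ψ b' w h' P αw Q αf).map ((Over.star P).map f) ≫
        OverStar.ιHom (Hom.branchLocalFunctor ψ b' w h' P αw Q αf)
          (𝒦.pull (ψ.base.branchMap b') (ψ.base.vertexMap w) (ψ.base.abuts_branchMap b' w h')).pullback
          (Hom.branchLocalIso ψ b' w h' P αw Q αf ew ef) U' ≫ k =
      OverStar.ιHom (Hom.branchLocalFunctor ψ b' w h' P αw Q αf)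
          (𝒦.pull (ψ.base.branchMap b') (ψ.base.vertexMap w) (ψ.base.abuts_branchMap b' w h')).pullback
          (Hom.branchLocalIso ψ b' w h' P αw Q αf ew ef) U ≫
        (Over.star Q).map ((𝒦.pull (ψ.base.branchMap b') (ψ.base.vertexMap w)
          (ψ.base.abuts_branchMap b' w h')).pullback.map f) ≫ k := fun f _ k => by
    rw [← Category.assoc, OverStar.ιHom_naturality, Category.assoc]
  rw [← Functor.map_comp_assoc, ← hεV, OverStar.pullbackι, hun,
    Functor.map_comp_assoc, Functor.map_comp_assoc,
    ← OverStar.ιHom_eq (Hom.branchLocalFunctor ψ b' w h' P αw Q αf)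
      (𝒦.pull (ψ.base.branchMap b') (ψ.base.vertexMap w) (ψ.base.abuts_branchMap b' w h')).pullback
      (Hom.branchLocalIso ψ b' w h' P αw Q αf ew ef),
    hιn, hιn, ← reassoc_of% hεB, OverStar.pullbackι]
  simp only [Functor.map_comp, Category.assoc]

end Hom

end SemiGraphOfAnabelioids

end Literature.AnabelianGeometry.SemiGraphs
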